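import Summits.BirchSwinnertonDyer.BirchSwinnertonDyer.Theorems.EisensteinPrimesMazurMCOnCellBEtaleEndCube
import Literature.NumberTheory.Waring.ElementaryBounds
import Literature.Barriers.BirchSwinnertonDyer.RankNotSumOfLocalInvariantsCubicTwists
import HarnessLib

/-!
# Crux `MazurMCOnCellB` (stmt-BirchSwinnertonDyer-19033), line `mudescent` v4 — the INTEGER READING of
# the `3`-adic cube test at the étale end: `n ∈ (ℚ₃^×)³ ⟹ 3 ∣ v₃(n) ∧ n/3^{v₃(n)} ≡ ±1 (mod 9)`

Width seat bsd-line-x2-p1-w2 (gen 5), `--supports -19033`, μ-lineage; sequel of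
`…MazurMCOnCellBEtaleEndCube` (`Δ_min ∈ (ℚ₃^×)³` at every X2 type-A étale end at `3`). THEOREMS ONLY
(no definition, no named fact, no `sorry`); nothing here proves a main conjecture, closes a stub or
moves a label. PURPOSE: census scripts decide «`Δ_min` is not a `3`-adic cube» from two integers —
`v₃(Δ_min) mod 3` and `(Δ_min / 3^{v₃(Δ_min)}) mod 9` —; this file puts that decision procedure in the
kernel, so that a census row's certificate IS the hypothesis of a theorem concluding
`HasRamifiedOddLineAt W 3` (the barrier locus) and `μ(X(E/ℚ_∞)) ≥ 1` (relative to Greenberg's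
Prop. 5.7).

* §1 `dvd_padicValInt_and_mod_nine_of_padic_cube` — for `n ≠ 0` in `ℤ` and `t ∈ ℚ₃` with `t³ = n`:
  `3 ∣ v₃(n)` and `n/3^{v₃(n)} ≡ ±1 (mod 9)` (in `ℤ₃`: `t = u·3^a`, `PadicInt.unitCoeff`; `u³ = n/3^{3a}`;
  reduce by `PadicInt.toZModPow 2`; cubes mod `9` are `0, ±1` = tree `Waring.pow_three_mod_nine`,
  Hardy–Wright §21.6); contrapositive `not_padic_cube_of_test`.
* §2 at the étale end: `minimalDiscriminantInt_test_of_notGVPar_offLocus` (every X2 type-A étale end at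
  `3` PASSES the test; `X2.CellB` / `X2.CellC` wrappers), `hasRamifiedOddLineAt_of_test_fails` (a
  type-A member FAILING it is ON the locus) and `one_le_mu_of_notGVPar_of_test_fails` (`μ ≥ 1` there,
  rel. Prop. 5.7 via `EisensteinMuBarrier.one_le_mu`).

HONEST FRAMING: elementary `3`-adic arithmetic + packaging; no main conjecture / BSD statement is
proved; 0 cells / labels / stubs move. The converse of §2 (Hensel: the test passing implies a cube)
is not needed by the instrument and not proved. References: [Serre1972] §5.3; [GreenbergLNM1716]
Prop. 5.7 (p. 113); [GreenbergVatsal2000] §2 p. 28.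
-/

set_option autoImplicit false

-- `Summit.BirchSwinnertonDyer.BirchSwinnertonDyer.…`: the summit and its single sub-problem share a name (D-0017 layout).
set_option linter.dupNamespace false

noncomputable section

open scoped Classical

open WeierstrassCurve
  Literature.NumberTheory.EllipticCurves
  Literature.NumberTheory.EllipticCurves.Rank1Residual
  Literature.Barriers.BirchSwinnertonDyer
  Summit.BirchSwinnertonDyer.Rank1Residual
  Summit.BirchSwinnertonDyer.BirchSwinnertonDyer.Theorems.EisensteinPrimesMazurMCOnCellBEtaleEndCube

namespace Summit.BirchSwinnertonDyer.BirchSwinnertonDyer.Theorems.EisensteinPrimesMazurMCOnCellBEtaleEndCubeTest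

/-! ## §1 A non-zero integer which is a cube in `ℚ₃` (the cubes of `ℤ/9` are `0, ±1`: tree
`Literature.NumberTheory.Waring.pow_three_mod_nine`, Hardy–Wright §21.6) -/

/-- **The integer reading of «`n` is a cube in `ℚ₃`».** For a non-zero integer `n` and `t ∈ ℚ₃`
with `t³ = n`: `3 ∣ v₃(n)` and the unit part `n / 3^{v₃(n)}` is `≡ ±1 (mod 9)`. Proof in `ℤ₃`:
`t ∈ ℤ₃` (`‖t‖³ = ‖n‖ ≤ 1`), `t = u · 3^a` with `u ∈ ℤ₃^×` (`PadicInt.unitCoeff`), so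
`v₃(n) = 3a` and `u³ = n/3^{3a}`; reducing modulo `9` (`PadicInt.toZModPow 2`) the cube `u³` is
`0` or `±1`, and `0` is excluded since `3 ∤ n/3^{v₃(n)}`. [folklore] -/
theorem dvd_padicValInt_and_mod_nine_of_padic_cube {n : ℤ} (hn : n ≠ 0) {t : ℚ_[3]}
    (ht : t ^ 3 = (n : ℚ_[3])) :
    3 ∣ padicValInt 3 n ∧
      (((n / 3 ^ padicValInt 3 n : ℤ) : ZMod 9) = 1 ∨
        ((n / 3 ^ padicValInt 3 n : ℤ) : ZMod 9) = -1) := by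
  -- `t` is a `3`-adic integer
  have ht1 : ‖t‖ ≤ 1 := by
    have h3 : ‖t‖ ^ 3 ≤ 1 := by
      rw [← norm_pow, ht]; exact Padic.norm_int_le_one n
    by_contra hlt
    push Not at hlt
    have : 1 < ‖t‖ ^ 3 := one_lt_pow₀ hlt (by norm_num)
    exact absurd h3 (not_le.mpr this)
  set T : ℤ_[3] := ⟨t, ht1⟩ with hT
  have hT3 : T ^ 3 = (n : ℤ_[3]) := Subtype.ext (by
    rw [PadicInt.coe_pow, PadicInt.coe_intCast]; exact ht)
  have hn3 : (n : ℤ_[3]) ≠ 0 := by exact_mod_cast hn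
  have hT0 : T ≠ 0 := by
    intro h; apply hn3; rw [← hT3, h]; ring
  -- valuation: `v₃(n) = 3 · v(T)`
  have hvaln : (n : ℤ_[3]).valuation = padicValInt 3 n := by
    have h := PadicInt.valuation_coe (n : ℤ_[3])
    rw [PadicInt.coe_intCast, Padic.valuation_intCast] at h
    exact_mod_cast h.symm
  have hv : padicValInt 3 n = 3 * T.valuation := by
    rw [← hvaln, ← hT3, PadicInt.valuation_pow]
  refine ⟨⟨T.valuation, hv⟩, ?_⟩
  -- unit part: `n = m · 3^v`, `u³ = m`
  set v : ℕ := padicValInt 3 n with hvdef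
  set m : ℤ := n / 3 ^ v with hm
  have hnm : n = m * 3 ^ v := by
    rw [hm]
    exact (Int.ediv_mul_cancel (by exact_mod_cast padicValInt_dvd (p := 3) n)).symm
  have hm3 : ¬ (3 : ℤ) ∣ m := by
    intro hd
    have hdiv : (3 : ℤ) ^ (v + 1) ∣ n := by
      rw [hnm, pow_succ, mul_comm ((3 : ℤ) ^ v)]
      exact mul_dvd_mul hd dvd_rfl
    rcases (padicValInt_dvd_iff (p := 3) (v + 1) n).mp (by exact_mod_cast hdiv) with h | h
    · exact hn h
    · rw [hvdef] at h; omega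
  set u : ℤ_[3] := (PadicInt.unitCoeff hT0 : ℤ_[3]) with hu
  have hspec : T = u * (3 : ℤ_[3]) ^ T.valuation := by
    rw [hu]; exact_mod_cast PadicInt.unitCoeff_spec hT0
  have hu3 : u ^ 3 = (m : ℤ_[3]) := by
    have h1 : T ^ 3 = u ^ 3 * (3 : ℤ_[3]) ^ v := by
      rw [hspec, mul_pow, ← pow_mul, mul_comm T.valuation 3, ← hv]
    have h2 : (n : ℤ_[3]) = (m : ℤ_[3]) * (3 : ℤ_[3]) ^ v := by
      rw [hnm]; push_cast; ring
    have h12 : u ^ 3 * (3 : ℤ_[3]) ^ v = (m : ℤ_[3]) * (3 : ℤ_[3]) ^ v := by rw [← h1, hT3, h2]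
    exact mul_right_cancel₀ (pow_ne_zero _ (by exact_mod_cast (show (3 : ℤ) ≠ 0 by norm_num))) h12
  -- reduce modulo `9 = 3²`
  have h9 : (PadicInt.toZModPow 2 u) ^ 3 = ((m : ZMod (3 ^ 2))) := by
    rw [← map_pow, hu3, map_intCast]
  have hm9 : ((m : ZMod (3 ^ 2))) ≠ 0 := by
    intro h0
    rw [ZMod.intCast_zmod_eq_zero_iff_dvd] at h0
    exact hm3 ((dvd_pow_self (3 : ℤ) two_ne_zero).trans (by exact_mod_cast h0))
  rcases Literature.NumberTheory.Waring.pow_three_mod_nine (PadicInt.toZModPow 2 u) with h | h | h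
  · exact absurd (h9.symm.trans h) hm9
  · exact Or.inl (h9.symm.trans h)
  · exact Or.inr (h9.symm.trans h)

/-- **Contrapositive — the census test**: a non-zero integer `n` with `3 ∤ v₃(n)`, or with unit part
`n/3^{v₃(n)} ≢ ±1 (mod 9)`, is NOT a cube in `ℚ₃`. [folklore] -/
theorem not_padic_cube_of_test {n : ℤ} (hn : n ≠ 0)
    (h : ¬ 3 ∣ padicValInt 3 n ∨
      (((n / 3 ^ padicValInt 3 n : ℤ) : ZMod 9) ≠ 1 ∧
        ((n / 3 ^ padicValInt 3 n : ℤ) : ZMod 9) ≠ -1)) :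
    ¬ ∃ t : ℚ_[3], t ^ 3 = (n : ℚ_[3]) := by
  rintro ⟨t, ht⟩
  obtain ⟨hv, hm⟩ := dvd_padicValInt_and_mod_nine_of_padic_cube hn ht
  rcases h with h | ⟨h1, h2⟩
  · exact h hv
  · rcases hm with hm | hm
    · exact h1 hm
    · exact h2 hm

/-! ## §2 At the étale end: the test on `Δ_min`, and its failure puts a type-A member ON the locus -/

/-- **Every X2 type-A étale end at `p = 3` passes the integer test on `Δ_min`**: `3 ∣ v₃(Δ_min)`
(already `…EtaleEndAtP.dvd_padicValInt_minimalDiscriminantInt_of_notGVPar_offLocus`) AND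
`Δ_min / 3^{v₃(Δ_min)} ≡ ±1 (mod 9)` — the kernel form of the census column of
`…EtaleEndCube` (147/147 étale-side members of the 127 A10 classes). [cite: Serre1972, §5.3]
[cite: GreenbergVatsal2000, §2 p. 28] -/
theorem minimalDiscriminantInt_test_of_notGVPar_offLocus {W : WeierstrassCurve ℚ} [W.IsElliptic]
    [W.IsGloballyMinimal] (hmult : W.HasMultiplicativeReductionAtPrime 3)
    (hred : ¬ W.HasIrreducibleModPGaloisRep 3) (hA : ¬ GVPar W 3) (hoff : ¬ HasRamifiedOddLineAt W 3) :
    3 ∣ padicValInt 3 W.minimalDiscriminantInt ∧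
      (((W.minimalDiscriminantInt / 3 ^ padicValInt 3 W.minimalDiscriminantInt : ℤ) : ZMod 9) = 1 ∨
        ((W.minimalDiscriminantInt / 3 ^ padicValInt 3 W.minimalDiscriminantInt : ℤ) : ZMod 9) = -1) := by
  obtain ⟨t, ht⟩ := exists_padic_pow_three_eq_Δ_of_notGVPar_offLocus hmult hred hA hoff
  refine dvd_padicValInt_and_mod_nine_of_padic_cube (minimalDiscriminantInt_ne_zero W) (t := t) ?_
  rw [ht, ← cast_minimalDiscriminantInt W, Rat.cast_intCast]

/-- Row A10 wrapper: an X2b étale end at `3` passes the test. [cite: Serre1972, §5.3] -/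
theorem minimalDiscriminantInt_test_of_cellB_offLocus {W : WeierstrassCurve ℚ} [W.IsElliptic]
    [W.IsGloballyMinimal] (hc : X2.CellB W 3) (hoff : ¬ HasRamifiedOddLineAt W 3) :
    3 ∣ padicValInt 3 W.minimalDiscriminantInt ∧
      (((W.minimalDiscriminantInt / 3 ^ padicValInt 3 W.minimalDiscriminantInt : ℤ) : ZMod 9) = 1 ∨
        ((W.minimalDiscriminantInt / 3 ^ padicValInt 3 W.minimalDiscriminantInt : ℤ) : ZMod 9) = -1) :=
  minimalDiscriminantInt_test_of_notGVPar_offLocus hc.2.1.2.2 hc.2.1.2.1 hc.2.2 hoff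

/-- Row B11 wrapper: an X2c type-A étale end at `3` passes the test. [cite: Serre1972, §5.3] -/
theorem minimalDiscriminantInt_test_of_cellC_offLocus {W : WeierstrassCurve ℚ} [W.IsElliptic]
    [W.IsGloballyMinimal] (hc : X2.CellC W 3) (hA : ¬ GVPar W 3) (hoff : ¬ HasRamifiedOddLineAt W 3) :
    3 ∣ padicValInt 3 W.minimalDiscriminantInt ∧
      (((W.minimalDiscriminantInt / 3 ^ padicValInt 3 W.minimalDiscriminantInt : ℤ) : ZMod 9) = 1 ∨
        ((W.minimalDiscriminantInt / 3 ^ padicValInt 3 W.minimalDiscriminantInt : ℤ) : ZMod 9) = -1) :=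
  minimalDiscriminantInt_test_of_notGVPar_offLocus hc.2.2.2 hc.2.2.1 hA hoff

/-- **A type-A X2 member at `p = 3` FAILING the integer test on `Δ_min` lies ON the barrier locus**
(`HasRamifiedOddLineAt W 3`), hence has `μ(X(E/ℚ_∞)) ≥ 1` relative to Greenberg's Prop. 5.7
(`…EtaleEndCube.one_le_mu_of_notGVPar_of_not_cube`). The certificate a census script emits
(`3 ∤ v₃(Δ_min)` or `Δ_min/3^{v} mod 9 ∉ {1, 8}`) is exactly the hypothesis `h`.
[cite: GreenbergLNM1716, Prop. 5.7 (p. 113)] [cite: Serre1972, §5.3] -/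
theorem hasRamifiedOddLineAt_of_test_fails {W : WeierstrassCurve ℚ} [W.IsElliptic]
    [W.IsGloballyMinimal] (hmult : W.HasMultiplicativeReductionAtPrime 3)
    (hred : ¬ W.HasIrreducibleModPGaloisRep 3) (hA : ¬ GVPar W 3)
    (h : ¬ 3 ∣ padicValInt 3 W.minimalDiscriminantInt ∨
      (((W.minimalDiscriminantInt / 3 ^ padicValInt 3 W.minimalDiscriminantInt : ℤ) : ZMod 9) ≠ 1 ∧
        ((W.minimalDiscriminantInt / 3 ^ padicValInt 3 W.minimalDiscriminantInt : ℤ) : ZMod 9) ≠ -1)) :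
    HasRamifiedOddLineAt W 3 := by
  refine hasRamifiedOddLineAt_of_not_cube hmult hred hA fun ⟨t, ht⟩ ↦ ?_
  refine not_padic_cube_of_test (minimalDiscriminantInt_ne_zero W) h ⟨t, ?_⟩
  rw [ht, ← cast_minimalDiscriminantInt W, Rat.cast_intCast]

/-- **Failing the test ⟹ `μ(X(E/ℚ_∞)) ≥ 1`** (type-A X2 member at `p = 3`; every torsion cyclotomic
Selmer dual datum; relative to Greenberg's Prop. 5.7 through `EisensteinMuBarrier.one_le_mu`).
[cite: GreenbergLNM1716, Prop. 5.7 (p. 113)] -/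
theorem one_le_mu_of_notGVPar_of_test_fails
    (h57 : Greenberg1999.prop57_one_le_mu_of_ramified_odd_line)
    {W : WeierstrassCurve ℚ} [W.IsElliptic] [W.IsGloballyMinimal]
    (hmult : W.HasMultiplicativeReductionAtPrime 3) (hred : ¬ W.HasIrreducibleModPGaloisRep 3)
    (hA : ¬ GVPar W 3)
    (h : ¬ 3 ∣ padicValInt 3 W.minimalDiscriminantInt ∨
      (((W.minimalDiscriminantInt / 3 ^ padicValInt 3 W.minimalDiscriminantInt : ℤ) : ZMod 9) ≠ 1 ∧
        ((W.minimalDiscriminantInt / 3 ^ padicValInt 3 W.minimalDiscriminantInt : ℤ) : ZMod 9) ≠ -1))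
    {κ : ZpExtension ℚ 3} {γ : Field.absoluteGaloisGroup ℚ} (hκ : κ.IsCyclotomic)
    (hγ : κ.IsTopGenerator γ) (D : W.SelmerDualData κ γ) [Module.Finite (IwasawaAlgebra 3) D.X]
    (hD : D.IsTorsion) : 1 ≤ D.mu :=
  EisensteinMuBarrier.one_le_mu h57 (by decide) (Or.inr hmult)
    (hasRamifiedOddLineAt_of_test_fails hmult hred hA h) hκ hγ D hD


/-! ## §3 The converse (Hensel): the test is an EQUIVALENCE — APPEND (previous declarations
byte-identical) -/

/-- An integer `≡ ±1 (mod 9)` is congruent modulo `27` to the cube of a `3`-unit: `m = ±1 + 9b`,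
`a = ±1 + 3b`, `a³ − m = 27(b³ ± b²)`. [folklore] -/
theorem exists_cube_sub_dvd_twentyseven_of_mod_nine {m : ℤ}
    (hm : ((m : ℤ) : ZMod 9) = 1 ∨ ((m : ℤ) : ZMod 9) = -1) :
    ∃ a : ℤ, ¬ (3 : ℤ) ∣ a ∧ (27 : ℤ) ∣ a ^ 3 - m := by
  rcases hm with h | h
  · have h9 : ((9 : ℕ) : ℤ) ∣ 1 - m :=
      (ZMod.intCast_eq_intCast_iff_dvd_sub m 1 9).mp (by rw [h, Int.cast_one])
    obtain ⟨b, hb⟩ := h9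
    refine ⟨1 - 3 * b, fun ⟨c, hc⟩ ↦ by omega, b ^ 2 - b ^ 3, ?_⟩
    have hm' : m = 1 - 9 * b := by omega
    rw [hm']; ring
  · have h9 : ((9 : ℕ) : ℤ) ∣ -1 - m :=
      (ZMod.intCast_eq_intCast_iff_dvd_sub m (-1) 9).mp (by rw [h, Int.cast_neg, Int.cast_one])
    obtain ⟨b, hb⟩ := h9
    refine ⟨-1 - 3 * b, fun ⟨c, hc⟩ ↦ by omega, -(b ^ 2) - b ^ 3, ?_⟩
    have hm' : m = -1 - 9 * b := by omega
    rw [hm']; ring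

/-- **The converse: an integer passing the test IS a cube in `ℚ₃`.** For `n` with `3 ∣ v₃(n)` and
`n/3^{v₃(n)} ≡ ±1 (mod 9)` (so `n ≠ 0`): `n ∈ (ℚ₃^×)³` — the unit part is `≡ a³ (mod 27)` for a `3`-unit `a`
(previous lemma), hence a cube by Hensel's lemma for `X³ − m` at `p = 3` (tree
`Literature.Barriers.BirchSwinnertonDyer.CubicTwist.padicThree_isCube_of_dvd`, Mathlib
`hensels_lemma`), and `3^{v₃(n)} = (3^{v₃(n)/3})³`. [cite: Serre1973, Ch. II §2.2] -/
theorem padic_cube_of_test {n : ℤ} (hv : 3 ∣ padicValInt 3 n)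
    (hm : ((n / 3 ^ padicValInt 3 n : ℤ) : ZMod 9) = 1 ∨
      ((n / 3 ^ padicValInt 3 n : ℤ) : ZMod 9) = -1) :
    ∃ t : ℚ_[3], t ^ 3 = (n : ℚ_[3]) := by
  obtain ⟨w, hw⟩ := hv
  have hnm : n = (n / 3 ^ padicValInt 3 n) * 3 ^ padicValInt 3 n :=
    (Int.ediv_mul_cancel (by exact_mod_cast padicValInt_dvd (p := 3) n)).symm
  obtain ⟨a, ha, h27⟩ := exists_cube_sub_dvd_twentyseven_of_mod_nine hm
  obtain ⟨r, -, hr⟩ := CubicTwist.padicThree_isCube_of_dvd ha h27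
  refine ⟨r * (3 : ℚ_[3]) ^ w, ?_⟩
  rw [mul_pow, ← pow_mul, ← hr, mul_comm w 3, ← hw]
  conv_rhs => rw [hnm]
  push_cast
  ring

/-- **`n ∈ (ℚ₃^×)³ ⟺ 3 ∣ v₃(n) ∧ n/3^{v₃(n)} ≡ ±1 (mod 9)`** for a non-zero integer `n` — the census
column «cube test» is an EQUIVALENCE in the kernel. [cite: Serre1973, Ch. II §2.2] -/
theorem padic_cube_iff_test {n : ℤ} (hn : n ≠ 0) :
    (∃ t : ℚ_[3], t ^ 3 = (n : ℚ_[3])) ↔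
      3 ∣ padicValInt 3 n ∧
        (((n / 3 ^ padicValInt 3 n : ℤ) : ZMod 9) = 1 ∨
          ((n / 3 ^ padicValInt 3 n : ℤ) : ZMod 9) = -1) :=
  ⟨fun ⟨_, ht⟩ ↦ dvd_padicValInt_and_mod_nine_of_padic_cube hn ht,
    fun ⟨hv, hm⟩ ↦ padic_cube_of_test hv hm⟩

/-- **`Δ_min ∈ (ℚ₃^×)³ ⟺ the test on `Δ_min`** for every globally minimal elliptic `W/ℚ` (no reduction
hypothesis): the census column of `…EtaleEndCube` / «cube-column @3» decided from two integers, both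
directions kernel. [cite: Serre1973, Ch. II §2.2] -/
theorem cube_Δ_iff_minimalDiscriminantInt_test (W : WeierstrassCurve ℚ) [W.IsElliptic]
    [W.IsGloballyMinimal] :
    (∃ t : ℚ_[3], t ^ 3 = (W.Δ : ℚ_[3])) ↔
      3 ∣ padicValInt 3 W.minimalDiscriminantInt ∧
        (((W.minimalDiscriminantInt / 3 ^ padicValInt 3 W.minimalDiscriminantInt : ℤ) : ZMod 9) = 1 ∨
          ((W.minimalDiscriminantInt / 3 ^ padicValInt 3 W.minimalDiscriminantInt : ℤ) : ZMod 9) = -1) := by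
  rw [← padic_cube_iff_test (minimalDiscriminantInt_ne_zero W), ← cast_minimalDiscriminantInt W,
    Rat.cast_intCast]

end Summit.BirchSwinnertonDyer.BirchSwinnertonDyer.Theorems.EisensteinPrimesMazurMCOnCellBEtaleEndCubeTest

end
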